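import Summits.BirchSwinnertonDyer.BirchSwinnertonDyer.Theses.UniversalToricDescent
import Summits.BirchSwinnertonDyer.BirchSwinnertonDyer.Theorems.EisensteinPrimesHidaLimitFittingBoundConverse
import Summits.BirchSwinnertonDyer.Rank1Residual.X11b.BDPRouteOpenInputDegenerateFrame
import Literature.NumberTheory.EllipticCurves.CyclotomicIwasawaMainTheoremIrreducibleProofs
import HarnessLib

/-!
# NODE (D-0171) on crux stmt-BirchSwinnertonDyer-24207 `UniversalToricDescent.RationalSplitIMCInclusionAtThree`
# — idea `bounded-resolvent-twist-door` (crux-ideate seat `cruxidea-stmt-BirchSwinnertonDyer-24207-1` gen 5, 2026-08-30)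

KIND: DOOR (EQUIV) + NEGATIVE LEMMA.  The crux (rational Kolyvagin-direction wall
`∃ k, 3ᵏ·L ∈ Ch_Λ(X_(∅,0))·R₀⟦T⟧`) is rewritten WITHOUT any tower, Λ-module structure theory or local condition at `3` on
the algebraic side: writing `Ch_Λ(X_(∅,0))·R₀⟦T⟧ = (F)`, the inclusion holds iff the meromorphic RESOLVENT `L/F` is
BOUNDED on the open unit disc of `ℂ₃`, i.e. iff `‖L(x)‖ ≤ 3^C·‖F(x)‖` uniformly in `‖x‖ < 1` (piece **D**, pure `3`-adic
analysis over `R₀ = unrIntegers 3`: Weierstrass preparation + "a polynomial of degree < deg P vanishing on the roots of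
P is 0"; the converse `3ᵏL = F·H ⇒ ‖L(x)‖ ≤ 3ᵏ‖F(x)‖` is piece **Dc**, evidence for EQUIV, not used by the composition).
At an algebraic point `x = ψ(γ) − 1` (`ψ : Γ^{ac} → 𝓞_L^×` ANY continuous character, `L/ℚ₃` finite, possibly ramified,
`ψ` of infinite order) `‖F(x)‖⁻¹ = #(X_(∅,0) ⊗ 𝓞_L(ψ))_Γ = # Sel_(∅,0)(K, T ⊗ ψ ⊗ L/𝓞_L)` up to a constant uniform in
`ψ` (anticyclotomic control: `E(K_∞)[3] = 0` as `ρ̄₃` is onto; no error at the relaxed prime `𝔭`; at the strict prime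
`𝔭'` the error is `E(K_{∞,𝔭'})[3^∞]`, a FIXED finite group — finite because `K_{∞,𝔭'}/ℚ₃` is a `ℤ₃`-extension
`≠ ℚ₃^{cyc}` and a Hodge–Tate character of infinite image factoring through a non-cyclotomic `ℤ₃`-extension does not
exist [leaf U-control, ATTACKABLE (S)]; Tamagawa errors bounded).  So piece **U** — the uniform value bound —
reads: *uniformly in the non-classical twist `ψ`, `# Sel_(∅,0)(K, T_ψ) ≤ 3^C · |ℒ_𝔭(ψ)|⁻²`* — Mazur–Rubin's
height-one-specialisation door [MazurRubin2004 §5.3, proof of Thm 5.3.10] typed for THIS wall, over the FIXED field `K`.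

NEGATIVE LEMMA (kernel core = `coinvariant_killed_of_norm_killed` below; arithmetic dressing in the card): for `ψ` of
infinite order with `ψ(γ) = u`, the `ψ`-corestriction `K_m → K` of every Heegner(-Kolyvagin) class of `3`-power conductor
is killed by `3^{c_ψ}` in `H¹(K, T_ψ/3^M)` for EVERY `M` (`c_ψ = 1` for all but at most one `m`): the class generates a
quotient of `ℤ₃[G_m]/(Φ_{3^m}(g)) = ℤ₃[ζ_{3^m}]` (trace-zero tower, `U₃ f_E = 0`), whose `ψ`-coinvariants are
`𝓞_L/Φ_{3^m}(u)` with `v₃(Φ_{3^m}(u)) = min(φ(3^m)·v₃(u−1), 1) ≤ 1`.  Hence Heegner points are INVISIBLE in U: the third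
formal incarnation of `TraceZeroHeegnerTowerAtAdditiveSplitP` (after K1 «no Λ-adic class» and gen 4/5 «no canonical germ»),
now at the bottom layer.  Consequence recorded on the card: any supply for U is Λ-adic in origin (specialisation of
classes in `H¹_{Iw,(∅,∅)}`, Λ-rank 2) — the rank-2 supply problem shared with 20395's `wedge-square-host` /
`nakayama-anchor` / `epsilon-supply`; the door does NOT evade the lineage meta-barrier «no local line over ℚ₃ on SC rows».

TAGS.  **D** [WEAKER · ATTACKABLE (M): `3`-adic Weierstrass preparation over the complete DVR `unrIntegers 3`
(tree: `X2.HidaLimitAlgebra.isDiscreteValuationRing_unrIntegers`; Mathlib `PowerSeries` Weierstrass division) + values of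
products (`IntSeries.HasValueAt.mul`, `KatzMeasureMonomialLines`)].  **Dc** [WEAKER · ATTACKABLE (S) · ASIDE: evidence
that U is implied by the crux].  **U** [EQUIV (by D ∧ Dc) · UNDECIDED; leaf U-supply IDEA-NEEDED (rank-2 Λ-adic supply at
non-classical `ψ`), U-Heegner BARRIER (negative lemma: Heegner-fed Kolyvagin arguments give `κ₁ ≈ 0` at every
infinite-order `ψ`), U-classical INSTRUMENTABLE (at `ℚ₃`-rational `ψ = ⟨κ⟩^s`, `s ∈ ℤ₃`, BDP points `(j,−j)`, `j → s`,
accumulate: the LEAD comb's tooth classes specialise there — pointwise index test with a uniform constant)].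
Composition (kernel, BY NAME): **D ∧ U ⟹ 24207** (`rationalSplitIMCInclusionAtThree_of_door_of_uniformTwisted`):
principality of `Ch·R₀⟦T⟧` (`charIdeal_isPrincipal_holds`), `F ≠ 0` (`Module.charIdeal_ne_bot` + `map_toUnr_injective`),
torsion dichotomy (`charIdeal_eq_top_of_not_isTorsion`).  No `sorry`, no new axioms, no banned options.
-/

open scoped Classical TensorProduct

namespace Summit.BirchSwinnertonDyer.BirchSwinnertonDyer.Cruxes.RationalSplitIMCInclusionAtThree.BoundedResolventTwistDoor

open PowerSeries Literature.NumberTheory.EllipticCurves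
  Summit.BirchSwinnertonDyer.Rank1Residual.X11b

/-- The uniform value bound `‖L(x)‖ ≤ 3^C · ‖F(x)‖` on the open unit disc of `ℂ₃` (values via the tree's
`UnrSeries.HasValueAt`).  For `F` a generator of `Ch_Λ(X_(∅,0))·R₀⟦T⟧`: boundedness of the resolvent `L/F`. -/
def UniformValueBound (F L : UnrSeries 3) : Prop :=
  ∃ C : ℕ, ∀ x vF vL : ℂ_[3], ‖x‖ < 1 → F.HasValueAt x vF → L.HasValueAt x vL → ‖vL‖ ≤ (3 : ℝ) ^ C * ‖vF‖

/-- **D [WEAKER · ATTACKABLE (M)]** the bounded-resolvent door: a bounded resolvent has no poles in the open disc, so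
every root of `F` there is a root of `L` with multiplicity, and Weierstrass division by the distinguished part `P` of
`F = 3^μ·P·unit` leaves remainder `0`; `k = μ(F)`. [folklore: Lazard 1962 (zeros of bounded analytic functions on the
open disc); Washington §7.1 (Weierstrass preparation)] -/
def BoundedResolventDoor : Prop :=
  ∀ F L : UnrSeries 3, F ≠ 0 → UniformValueBound F L →
    ∃ k : ℕ, ((3 : ℕ) : UnrSeries 3) ^ k * L ∈ Ideal.span {F}

/-- **Dc [WEAKER · ATTACKABLE (S) · ASIDE — evidence for EQUIV]** the converse: `3ᵏ·L = F·H` with `H ∈ R₀⟦T⟧` gives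
`‖L(x)‖ = ‖F(x)‖·‖H(x)‖·3ᵏ ≤ 3ᵏ·‖F(x)‖` (`‖H(x)‖ ≤ 1` on the open disc). Not used by the composition. -/
def BoundedResolventDoorConverse : Prop :=
  ∀ F L : UnrSeries 3, (∃ k : ℕ, ((3 : ℕ) : UnrSeries 3) ^ k * L ∈ Ideal.span {F}) → UniformValueBound F L

/-- **U [EQUIV (via D, Dc) · UNDECIDED; leaves: supply IDEA-NEEDED, Heegner-supply BARRIER, classical points
INSTRUMENTABLE]** the uniform twisted value bound: on the wall's binders, if `X_(∅,0)` is Λ-torsion and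
`Ch_Λ(X_(∅,0))·R₀⟦T⟧ = (F)`, then `‖L(x)‖ ≤ 3^C‖F(x)‖` on the open disc — arithmetically: uniformly in the continuous
character `ψ` of `Γ^{ac}` (infinite order allowed), `# Sel_(∅,0)(K, T_ψ ⊗ L/𝓞_L) ≤ 3^C·|ℒ_𝔭(ψ)|_L⁻²`. -/
def UniformTwistedValueBoundAtThree : Prop :=
  ∀ (W : WeierstrassCurve ℚ) [W.IsElliptic] [W.IsGloballyMinimal] (N : ℕ) [NeZero N] (K : Type) [Field K] [NumberField K] (Dt : Literature.NumberTheory.EllipticCurves.ModularForms.ModularParametrizationData W N), Summit.BirchSwinnertonDyer.Rank1Residual.Additive.ClassO6 W 3 → W.HasSurjectiveModNGaloisRep 3 → W.analyticRank = 1 → W.conductorNorm ℤ = N → Literature.NumberTheory.EllipticCurves.IsImaginaryQuadratic K → Literature.NumberTheory.EllipticCurves.SatisfiesHeegnerHypothesis N K → ∀ (κ : Literature.NumberTheory.EllipticCurves.ZpExtension K 3), κ.IsAnticyclotomic → ∀ (γ : Field.absoluteGaloisGroup K) [Fact (κ.IsTopGenerator γ)] (𝔭 : IsDedekindDomain.HeightOneSpectrum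 (NumberField.RingOfIntegers K)), ((3 : ℕ) : NumberField.RingOfIntegers K) ∈ 𝔭.asIdeal → 𝔭.asIdeal.ramificationIdx (NumberField.RingOfIntegers ℚ) = 1 → 𝔭.asIdeal.inertiaDeg (NumberField.RingOfIntegers ℚ) = 1 → ∀ (𝔭' : IsDedekindDomain.HeightOneSpectrum (NumberField.RingOfIntegers K)), ((3 : ℕ) : NumberField.RingOfIntegers K) ∈ 𝔭'.asIdeal → 𝔭' ≠ 𝔭 → ∀ (ι' : PadicAlgCl 3 ≃+* ℂ), Summit.BirchSwinnertonDyer.BirchSwinnertonDyer.Theorems.SchneiderFree.BranchInducesPrime 3 ι' 𝔭 → ∀ (ΩK : ℂ) (Ωp : ℂ_[3]) (L : Literature.NumberTheory.EllipticCurves.UnrSeries 3), ΩK ≠ 0 → Ωp ≠ 0 → Literature.NumberTheory.EllipticCurves.IsBDPLFunction ι' 𝔭 κ γ Dt.f ΩK Ωp L → Module.IsTorsion (Literature.NumberTheory.EllipticCurves.IwasawaAlgebra 3) (Summit.BirchSwinnertonDyer.Rank1Residual.X11b.AcSelmer.XAc (W.baseChange K) 3 κ 𝔭' ∅ γ) →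 ∀ F : Literature.NumberTheory.EllipticCurves.UnrSeries 3, (Summit.BirchSwinnertonDyer.Rank1Residual.X11b.AcSelmer.XAc.charIdeal (W.baseChange K) 3 κ 𝔭' ∅ γ).map (PowerSeries.map (Summit.BirchSwinnertonDyer.Rank1Residual.X11b.Halves.toUnr 3)) = Ideal.span {F} → UniformValueBound F L

/-- The extended characteristic ideal is principal: `Ch_Λ(X)·R₀⟦T⟧ = (F)` (verbatim from the gen-3/gen-4 nodes). -/
theorem exists_map_charIdeal_eq_span {K : Type} [Field K] [NumberField K] (W : WeierstrassCurve K)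
    (κ : ZpExtension K 3) (𝔭' : IsDedekindDomain.HeightOneSpectrum (NumberField.RingOfIntegers K))
    (γ : Field.absoluteGaloisGroup K) [Fact (κ.IsTopGenerator γ)] :
    ∃ F : UnrSeries 3, (AcSelmer.XAc.charIdeal W 3 κ 𝔭' ∅ γ).map (PowerSeries.map (Halves.toUnr 3)) =
      Ideal.span {F} := by
  obtain ⟨f, hf⟩ := (charIdeal_isPrincipal_holds 3 (AcSelmer.XAc W 3 κ 𝔭' ∅ γ)).principal
  refine ⟨PowerSeries.map (Halves.toUnr 3) f, ?_⟩
  have hf' : AcSelmer.XAc.charIdeal W 3 κ 𝔭' ∅ γ = Ideal.span {f} := by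
    change Literature.NumberTheory.EllipticCurves.Module.charIdeal (IwasawaAlgebra 3) (AcSelmer.XAc W 3 κ 𝔭' ∅ γ) =
      Ideal.span {f}
    simpa [Ideal.submodule_span_eq] using hf
  rw [hf', Ideal.map_span, Set.image_singleton]

/-- The extended characteristic ideal is nonzero (`Ch_Λ ≠ ⊥` over a domain, `Λ → R₀⟦T⟧` injective). -/
theorem map_charIdeal_ne_bot {K : Type} [Field K] [NumberField K] (W : WeierstrassCurve K)
    (κ : ZpExtension K 3) (𝔭' : IsDedekindDomain.HeightOneSpectrum (NumberField.RingOfIntegers K))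
    (γ : Field.absoluteGaloisGroup K) [Fact (κ.IsTopGenerator γ)] :
    (AcSelmer.XAc.charIdeal W 3 κ 𝔭' ∅ γ).map (PowerSeries.map (Halves.toUnr 3)) ≠ ⊥ := by
  rw [Ne, Ideal.map_eq_bot_iff_of_injective map_toUnr_injective]
  exact Literature.NumberTheory.EllipticCurves.Module.charIdeal_ne_bot (IwasawaAlgebra 3) _

/-- **The idea's composition (kernel, BY NAME): D ∧ U ⟹ 24207.** -/
theorem rationalSplitIMCInclusionAtThree_of_door_of_uniformTwisted
    (hD : BoundedResolventDoor) (hU : UniformTwistedValueBoundAtThree) :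
    Summit.BirchSwinnertonDyer.BirchSwinnertonDyer.Theses.UniversalToricDescent.RationalSplitIMCInclusionAtThree := by
  intro W _ _ N _ K _ _ Dt hO6 hsurj hr1 hN hK hH κ hκ γ _ 𝔭 h𝔭 he hf 𝔭' h𝔭' hne ι' hι ΩK Ωp L hΩK hΩp hL
  by_cases htor : Module.IsTorsion (IwasawaAlgebra 3) (AcSelmer.XAc (W.baseChange K) 3 κ 𝔭' ∅ γ)
  · obtain ⟨F, hF⟩ := exists_map_charIdeal_eq_span (W.baseChange K) κ 𝔭' γ
    have hF0 : F ≠ 0 := by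
      intro h0
      apply map_charIdeal_ne_bot (W.baseChange K) κ 𝔭' γ
      rw [hF, h0, Ideal.span_singleton_eq_bot]
    have hb : UniformValueBound F L :=
      hU W N K Dt hO6 hsurj hr1 hN hK hH κ hκ γ 𝔭 h𝔭 he hf 𝔭' h𝔭' hne ι' hι ΩK Ωp L hΩK hΩp hL htor F hF
    obtain ⟨k, hk⟩ := hD F L hF0 hb
    exact ⟨k, by rw [hF]; exact hk⟩
  · refine ⟨0, ?_⟩
    have htop : AcSelmer.XAc.charIdeal (W.baseChange K) 3 κ 𝔭' ∅ γ = ⊤ :=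
      Summit.BirchSwinnertonDyer.BirchSwinnertonDyer.Theorems.charIdeal_eq_top_of_not_isTorsion (p := 3) _ htor
    rw [htop, Ideal.map_top]; exact Submodule.mem_top

/-- **Kernel core of the NEGATIVE LEMMA (Heegner points are invisible at infinite-order twists).**  `A` = the group
ring `ℤ₃[G_m]` (any commutative ring), `Y` = the Heegner module (any `A`-module), `φ = Φ_{3^m}(g)` the relative norm
`N_{K_m/K_{m−1}}` (any element), `O` = `𝓞_L/3^M` with the `A`-algebra structure `g ↦ ψ(g)` (any commutative
`A`-algebra), hypothesis `algebraMap A O φ ∣ t` (arithmetic input: `Φ_{3^m}(u) ∣ 3^{c_ψ}`): a trace-zero element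
`φ • y = 0` has `ψ`-coinvariant class `1 ⊗ y ∈ O ⊗_A Y` (= its `ψ`-corestriction, Shapiro) killed by `t`. -/
theorem coinvariant_killed_of_norm_killed {A : Type*} [CommRing A] {O : Type*} [CommRing O] [Algebra A O]
    {Y : Type*} [AddCommGroup Y] [Module A Y] (φ : A) (t : O) (ht : algebraMap A O φ ∣ t) (y : Y)
    (hy : φ • y = 0) : t • ((1 : O) ⊗ₜ[A] y) = 0 := by
  obtain ⟨w, hw⟩ := ht
  rw [hw, mul_comm, mul_smul, Algebra.algebraMap_eq_smul_one, TensorProduct.smul_tmul', smul_assoc, one_smul,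
    TensorProduct.smul_tmul, hy, TensorProduct.tmul_zero, smul_zero]

end Summit.BirchSwinnertonDyer.BirchSwinnertonDyer.Cruxes.RationalSplitIMCInclusionAtThree.BoundedResolventTwistDoor
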